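import Summits.QuantumFields.BalabanUV.InfraRed.StrongCouplingSixFifthsWindow
import Summits.QuantumFields.BalabanUV.InfraRed.StrongCouplingPoincareDoorSUN
import HarnessLib

/-!
# `SU(2)`: the one-link variance schema holds HYPOTHESIS-FREE with the Haar constant `v = 2` on the ball `‖B‖_op ≤ 3/10`

HONEST FRAMING.  Explicit strong-coupling constants for lattice `SU(2)` Yang–Mills (small `β`): a statement about ONE tilted Haar
law on `SU(2)`.  NOT weak coupling, NOT a continuum statement, NOT a Yang–Mills mass-gap claim.  Cell `pub-ymgap` (venture `YMGap`),
track Y2 ROBUST-BALL, seat engine-2 (g5); 0 compute.  Nothing new is computed: this file only REPACKAGES the tree's `SU(2)` variance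
lemma (`pub-balaban` IR-SC, R20 + J-SC11: `StrongCouplingSixFifthsVariance.integral_var_tilted_le_six_fifths` — under the one-link law
`ν_B ∝ e^{2 Re tr(g B)} Haar` with `|2 Re tr(g B)| ≤ 6/5` the variance of the linear observable `2 Re tr(g Δ)` is at most its HAAR second
moment — together with `StrongCouplingKernelWindow.integral_sq_re_trace_su2_mul` / `coef_sq_le`: that moment is `|c(Δ)|²/4 · 4 ≤ 2‖Δ‖_F²`)
as an inhabitant of the NAMED schema `OneLinkVarianceBound N R v` of `StrongCouplingVarianceDoorSUN` at `N = 2`, `R = 3/10`, `v = 2`: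

* `oneLinkVarianceBound_two_threeTenths : OneLinkVarianceBound 2 (3/10) 2`.

WHY (Y2 bookkeeping).  With the tree's hypothesis-free sharp Poincaré constant `oneLinkPoincareSUN_two_sharp R : OneLinkPoincareSUN 2 R (2/3)`
this is the `SU(2)` pair `(c, v) = (2/3, 2)` BY NAME, i.e. the Poincaré × variance modulus `√(c v) = √(4/3)` on `‖B‖_op ≤ 3/10` (Wilson
`β_W ≤ 1/5` at the single-link / slab radius `3β_W/2`; the tree's `oneLinkKRModulusSU2_sharp` is the same modulus in `K₂` units) — the input
shape of the robust one-link lemma in Holley–Stroock form (`OneLinkHolleyStroock.abs_integral_pert_sub_pert_le_of_pair`, engine-2; rb-p1's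
`RobustOneLink` takes the same two bodies), whose transfer factor is `e^{a}` with NO self-Lipschitz factor `(1 + 2√2 ℓ_s)`.  No ledger number
moves here; the `(β⋆, ε)` rows are rb-p1/rb-ref's (ROBUST-BALL-DESIGN.md §6–7; engine-2 table ROBUST-ONELINK-TABLE.md §D).
-/

noncomputable section

open MeasureTheory ProbabilityTheory Real
open Literature.MathematicalPhysics.QuantumFieldTheory
open Literature.MathematicalPhysics.QuantumFieldTheory.Balaban1983to89.StrongCouplingKernelWindow
  (abs_re_trace_su2_mul_le_opNorm integral_sq_re_trace_su2_mul coef_sq_le)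
open Literature.MathematicalPhysics.QuantumFieldTheory.Balaban1983to89.StrongCouplingVarianceWindow (pot)
open Summit.QuantumFields.BalabanUV.InfraRed.StrongCouplingSixFifthsVariance (integral_var_tilted_le_six_fifths continuous_pot abs_pot_le)
open Summit.QuantumFields.BalabanUV.InfraRed.StrongCouplingVarianceDoorSUN (OneLinkVarianceBound)

namespace Summit.Ventures.YMGap.OneLinkVarianceBoundSU2

/-- **`OneLinkVarianceBound 2 (3/10) 2`, hypothesis-free.**  For every `B ∈ M₂(ℂ)` with `‖B‖_op ≤ 3/10` (so `|2 Re tr(g B)| ≤ 4‖B‖_op ≤ 6/5`)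
and every direction `Δ`: `Var_{ν_B}(2 Re tr(g Δ)) ≤ ∫ (2 Re tr(g Δ))² dHaar = |c(Δ)|² ≤ 2 ‖Δ‖_F²` — the tree's `integral_var_tilted_le_six_fifths`
(axis reduction + the two one-dimensional inequalities of `pub-balaban` R20/J-SC11) and `integral_sq_re_trace_su2_mul` + `coef_sq_le` (Parseval on
the unit quaternions), repackaged in the schema of `StrongCouplingVarianceDoorSUN`. [folklore] -/
theorem oneLinkVarianceBound_two_threeTenths : OneLinkVarianceBound 2 (3 / 10) 2 := by
  intro B hB Δ
  have hpotB : (fun g : Matrix.specialUnitaryGroup (Fin 2) ℂ => ((2 : ℕ) : ℝ) * ((g : Matrix (Fin 2) (Fin 2) ℂ) * B).trace.re) = pot B := by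
    funext g; simp only [pot, Nat.cast_ofNat]
  have hpotΔ : (fun g : Matrix.specialUnitaryGroup (Fin 2) ℂ => ((2 : ℕ) : ℝ) * ((g : Matrix (Fin 2) (Fin 2) ℂ) * Δ).trace.re) = pot Δ := by
    funext g; simp only [pot, Nat.cast_ofNat]
  rw [hpotB, hpotΔ]
  -- the tilt is pointwise at most `6/5`
  have hB1 : ∀ g : Matrix.specialUnitaryGroup (Fin 2) ℂ, |pot B g| ≤ 6 / 5 := fun g => by
    simp only [pot]
    rw [abs_mul, abs_two]
    calc 2 * |((g : Matrix (Fin 2) (Fin 2) ℂ) * B).trace.re| ≤ 2 * (2 * matrixOpNorm B) :=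
          mul_le_mul_of_nonneg_left (abs_re_trace_su2_mul_le_opNorm g B) zero_le_two
      _ ≤ 6 / 5 := by linarith
  -- the one-link law is a probability measure
  have hexp : Integrable (fun s => exp (pot B s)) (haarProbability (Matrix.specialUnitaryGroup (Fin 2) ℂ)) :=
    integrable_of_measurable_of_abs_le (continuous_pot B).measurable.exp (C := exp (6 / 5)) fun s => by
      rw [abs_of_nonneg (exp_pos _).le]; exact exp_le_exp.2 ((le_abs_self _).trans (hB1 s))
  haveI : IsProbabilityMeasure ((haarProbability (Matrix.specialUnitaryGroup (Fin 2) ℂ)).tilted (pot B)) :=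
    isProbabilityMeasure_tilted hexp
  -- Haar second moment of the linear observable: `≤ 2 ‖Δ‖_F²`
  have hEσ : ∫ s, pot Δ s ^ 2 ∂(haarProbability (Matrix.specialUnitaryGroup (Fin 2) ℂ)) ≤ 2 * frobNorm Δ ^ 2 := by
    have hw2 : ∀ s : Matrix.specialUnitaryGroup (Fin 2) ℂ, pot Δ s ^ 2 = 4 * (((s : Matrix (Fin 2) (Fin 2) ℂ) * Δ).trace.re) ^ 2 :=
      fun s => by simp only [pot]; ring
    simp_rw [hw2]
    rw [integral_const_mul, integral_sq_re_trace_su2_mul]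
    linarith [coef_sq_le Δ]
  rw [variance_eq_integral (continuous_pot Δ).measurable.aemeasurable]
  exact (integral_var_tilted_le_six_fifths B Δ hB1).trans hEσ

/-- In Wilson units: for `0 ≤ β_W ≤ 1/5` the single-link / slab tilt radius `3β_W/2` is at most `3/10`, so `OneLinkVarianceBound 2 (3β_W/2) 2`.
[folklore] -/
theorem oneLinkVarianceBound_two_of_le_fifth {βW : ℝ} (h5 : βW ≤ 1 / 5) : OneLinkVarianceBound 2 (3 * βW / 2) 2 :=
  oneLinkVarianceBound_two_threeTenths.mono (by linarith) le_rfl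

/-- Numbers: the modulus `√((2/3)·2) = √(4/3)` of the pair `(c, v) = (2/3, 2)` lies in `(1.1547, 1.1548)` (vs the Poincaré-only `4/3` of lineage R and
the quarter modulus `1`); the radius identity `3·(1/5)/2 = 3/10`; the Wilson single-link constant `18·(β_W/4)·√(4/3)` closes (`= 1`) at `β_W = √3/9`:
here only the rational brackets `(9/2)·(1/5)·1.1547 > 1 > (9/2)·(19/100)·1.1548`. [folklore] -/
theorem su2_pair_numbers :
    (2 / 3 : ℝ) * 2 = 4 / 3 ∧ (1.1547 : ℝ) ^ 2 < 4 / 3 ∧ (4 / 3 : ℝ) < 1.1548 ^ 2 ∧ (3 : ℝ) * (1 / 5) / 2 = 3 / 10 ∧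
      (1 : ℝ) < 9 / 2 * (1 / 5) * 1.1547 ∧ (9 / 2 : ℝ) * (19 / 100) * 1.1548 < 1 := by
  norm_num

end Summit.Ventures.YMGap.OneLinkVarianceBoundSU2

end
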